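import Mathlib
import HarnessLib
import Literature.Analysis.FluidPDE.SuitableWeak
import Literature.Analysis.FluidPDE.SelfSimilar
import Literature.Analysis.FluidPDE.LocalTypeI
import Literature.Analysis.FluidPDE.LocalTypeICongr
import Literature.Analysis.FluidPDE.ParasiticSlabFlow
import Literature.Analysis.FluidPDE.TypeIRateOseenMildRepresentative
import Summits.NavierStokesRegularity.NavierStokesRegularity.Theorems.RellichScarApexLocalisationSpherePersistence
import Summits.NavierStokesRegularity.NavierStokesRegularity.Theorems.RellichScarApexLocalisationMildEquivalence
import Summits.NavierStokesRegularity.NavierStokesRegularity.Theses.RellichScar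

/-!
# The bet of line `activity-genealogy-fission` is implied by the crux (route RellichScar, crux
`ApexLocalisation`, stmt-NavierStokesRegularity-11719; lead c2)

`noPerpetualFission_of_apexLocalisation`: the crux `RellichScar.ApexLocalisation` implies the
registered bet `stub_noPerpetualFission` (window form of "no perpetual fission") of skeleton v2 of
the line — with the composition `ApexLocalisation_of` of that skeleton (E, S1a, S1b, S2 known) the
bet is therefore EXACTLY as strong as the crux. Proof: the apex profile delivered by the crux has a
continuous Oseen-mild representative (`exists_oseenMild_repr_of_typeIBound_lt_top`) which keeps the
apex bound everywhere on the open slab (`norm_le_of_ae_of_continuousOn`); an apex profile with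
constant `C'` is `η`-quiet outside the paraboloid of aperture `R = C'/η + 1` at every scale, hence on
every window.
-/

-- the summit and its single sub-problem share the name (CONVENTIONS §1), as in every Theorems file
set_option linter.dupNamespace false

namespace Summit.NavierStokesRegularity.NavierStokesRegularity.Theorems.RellichScarApexLocalisation

open MeasureTheory Set Function Metric Filter Topology TopologicalSpace
open scoped ENNReal NNReal
open Literature.Analysis Literature.Analysis.FluidPDE

/-- **An apex profile is quiet outside a paraboloid.** If `‖u(t,x)‖ ≤ C'/(‖x‖ + √(−t))` on the open
slab, `0 < η` and `R = C'/η + 1`, then `√(−t) ‖u(t,x)‖ ≤ η` whenever `t < 0` and `R √(−t) ≤ ‖x‖`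
(`√(−t) C'/(‖x‖ + √(−t)) ≤ √(−t) C'/(R √(−t)) = C'/R ≤ η`). -/
theorem quiet_of_hasTypeIDecay {C' η : ℝ} {u : ℝ → (EuclideanSpace ℝ (Fin 3)) → (EuclideanSpace ℝ (Fin 3))} (hdec : HasTypeIDecay C' u)
    (hη : 0 < η) {t : ℝ} (ht : t < 0) {x : (EuclideanSpace ℝ (Fin 3))} (hx : (C' / η + 1) * Real.sqrt (-t) ≤ ‖x‖) :
    Real.sqrt (-t) * ‖u t x‖ ≤ η := by
  have hC' : 0 ≤ C' := nonneg_of_hasTypeIDecay hdec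
  have hs : 0 < Real.sqrt (-t) := Real.sqrt_pos.2 (by linarith)
  have hR : 0 < C' / η + 1 := by positivity
  have hxpos : 0 < ‖x‖ := lt_of_lt_of_le (mul_pos hR hs) hx
  have hden : 0 < ‖x‖ + Real.sqrt (-t) := by positivity
  have h1 : ‖u t x‖ ≤ C' / (‖x‖ + Real.sqrt (-t)) := hdec t ht x
  -- `√(−t) C' ≤ η ‖x‖` because `(C'/η + 1) √(−t) ≤ ‖x‖`
  have h2 : Real.sqrt (-t) * C' ≤ η * ‖x‖ := by
    have h3 : η * ((C' / η + 1) * Real.sqrt (-t)) ≤ η * ‖x‖ :=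
      mul_le_mul_of_nonneg_left hx hη.le
    have h4 : η * ((C' / η + 1) * Real.sqrt (-t)) = Real.sqrt (-t) * C' + η * Real.sqrt (-t) := by
      field_simp
    rw [h4] at h3
    nlinarith [mul_pos hη hs]
  calc Real.sqrt (-t) * ‖u t x‖ ≤ Real.sqrt (-t) * (C' / (‖x‖ + Real.sqrt (-t))) :=
        mul_le_mul_of_nonneg_left h1 hs.le
    _ = Real.sqrt (-t) * C' / (‖x‖ + Real.sqrt (-t)) := by ring
    _ ≤ η * ‖x‖ / (‖x‖ + Real.sqrt (-t)) := div_le_div_of_nonneg_right h2 hden.le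
    _ ≤ η := by
        rw [div_le_iff₀ hden]
        nlinarith [mul_pos hη hs]

/-- **The crux implies the bet of line `activity-genealogy-fission`** (window form of "no perpetual
fission", verbatim the registered `stub_noPerpetualFission`): given `ApexLocalisation`, a rate-Type-I
singular slab profile yields an apex profile; its continuous Oseen-mild representative is a continuous
class profile `(C', 𝐈)` singular at the origin which, for every `η > 0`, is `η`-quiet outside the
paraboloid of aperture `C'/η + 1` at every point — in particular on every window. So the bet is
exactly as strong as the crux once the known stubs E, S1a, S1b, S2 of the skeleton are in. -/
theorem noPerpetualFission_of_apexLocalisation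
    (hcrux : Summit.NavierStokesRegularity.NavierStokesRegularity.Theses.RellichScar.ApexLocalisation) :
    ∀ C : ℝ, (∃ (u : ℝ → (EuclideanSpace ℝ (Fin 3)) → (EuclideanSpace ℝ (Fin 3))) (p : ℝ → (EuclideanSpace ℝ (Fin 3)) → ℝ) (G : ℝ → (EuclideanSpace ℝ (Fin 3)) → (EuclideanSpace ℝ (Fin 3)) →L[ℝ] (EuclideanSpace ℝ (Fin 3))),
        IsSuitableWeakSolutionOn (slab (EuclideanSpace ℝ (Fin 3)) (Iio 0) isOpen_Iio) 1 0 u p ∧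
        HasWeakSpatialGradientOn (slab (EuclideanSpace ℝ (Fin 3)) (Iio 0) isOpen_Iio) u G ∧
        typeIBound (Set.Iio (0 : ℝ) ×ˢ Set.univ) u p G < ⊤ ∧ HasTypeITimeDecay C u ∧
        IsBackwardSingularPoint u 0) →
      ∃ (C₁ : ℝ) (I₁ : ℝ≥0∞), I₁ < ⊤ ∧ ∀ η : ℝ, 0 < η → ∃ R : ℝ, 0 < R ∧ ∀ ε : ℝ, 0 < ε →
        ∃ (u : ℝ → (EuclideanSpace ℝ (Fin 3)) → (EuclideanSpace ℝ (Fin 3))) (p : ℝ → (EuclideanSpace ℝ (Fin 3)) → ℝ) (G : ℝ → (EuclideanSpace ℝ (Fin 3)) → (EuclideanSpace ℝ (Fin 3)) →L[ℝ] (EuclideanSpace ℝ (Fin 3))),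
          IsSuitableWeakSolutionOn (slab (EuclideanSpace ℝ (Fin 3)) (Iio 0) isOpen_Iio) 1 0 u p ∧
          HasWeakSpatialGradientOn (slab (EuclideanSpace ℝ (Fin 3)) (Iio 0) isOpen_Iio) u G ∧
          typeIBound (Iio (0 : ℝ) ×ˢ univ) u p G ≤ I₁ ∧
          HasTypeITimeDecay C₁ u ∧
          ContinuousOn (uncurry u) (Iio (0 : ℝ) ×ˢ univ) ∧
          IsBackwardSingularPoint u 0 ∧
          ∀ t : ℝ, t < 0 → ∀ x : (EuclideanSpace ℝ (Fin 3)), ε ≤ ‖x‖ + Real.sqrt (-t) → ‖x‖ + Real.sqrt (-t) ≤ ε⁻¹ →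
            R * Real.sqrt (-t) ≤ ‖x‖ → Real.sqrt (-t) * ‖u t x‖ ≤ η := by
  intro C hant
  obtain ⟨C', u, p, G, hsw, hwg, hI, hdec, hsing⟩ := hcrux C hant
  have hC' : 0 ≤ C' := nonneg_of_hasTypeIDecay hdec
  have hrate : HasTypeITimeDecay C' u := hdec.hasTypeITimeDecay hC'
  -- the continuous Oseen-mild representative
  obtain ⟨v, hae, hvcont, -, -, hvC⟩ := exists_oseenMild_repr_of_typeIBound_lt_top hsw hrate hI
  have hconst : ∀ R : ℝ, 0 < R → Tendsto (fun _ : ℕ => eLpNorm (uncurry u - uncurry u) 3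
      (volume.restrict (parabolicCylinder R (0 : ℝ × (EuclideanSpace ℝ (Fin 3)))))) atTop (𝓝 0) := fun R _ => by
    simp only [sub_self, eLpNorm_zero]
    exact tendsto_const_nhds
  obtain ⟨hswv, hwgv, hIv, hsingv, -⟩ :=
    classData_congr_ae (B := typeIBound (Iio (0 : ℝ) ×ˢ univ) u p G) (W := fun _ => u)
      hae hsw hwg le_rfl hsing hconst
  -- the apex bound survives everywhere on the open slab
  have hae_apex : ∀ᵐ w ∂(volume.restrict (Iio (0 : ℝ) ×ˢ (univ : Set (EuclideanSpace ℝ (Fin 3))))),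
      ‖uncurry v w‖ ≤ C' / (‖w.2‖ + Real.sqrt (-w.1)) := by
    filter_upwards [hae, ae_restrict_mem (measurableSet_Iio.prod MeasurableSet.univ)] with w hw hwS
    rw [← hw]
    exact hdec w.1 (by simpa using hwS.1) w.2
  have hg : ContinuousOn (fun w : ℝ × (EuclideanSpace ℝ (Fin 3)) => C' / (‖w.2‖ + Real.sqrt (-w.1)))
      (Iio (0 : ℝ) ×ˢ (univ : Set (EuclideanSpace ℝ (Fin 3)))) := by
    refine continuousOn_const.div ?_ ?_
    · exact (continuous_snd.norm.add (continuous_fst.neg.sqrt)).continuousOn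
    · rintro ⟨t, x⟩ ⟨ht, -⟩
      have : 0 < Real.sqrt (-t) := Real.sqrt_pos.2 (by simpa using ht)
      positivity
  have hdecv : HasTypeIDecay C' v := fun t ht x =>
    norm_le_of_ae_of_continuousOn hvcont hg hae_apex t ht x
  -- the bet's data: the class `(C', 𝐈(u))`, aperture `C'/η + 1`, the same profile for every window
  refine ⟨C', typeIBound (Iio (0 : ℝ) ×ˢ univ) u p G, hI, fun η hη => ⟨C' / η + 1, by positivity,
    fun ε _ => ⟨v, p, G, hswv, hwgv, hIv, hvC, hvcont, hsingv, fun t ht x _ _ hx => ?_⟩⟩⟩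
  exact quiet_of_hasTypeIDecay hdecv hη ht hx

end Summit.NavierStokesRegularity.NavierStokesRegularity.Theorems.RellichScarApexLocalisation
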